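import Mathlib
import Summits.ResolutionOfSingularities.ResolutionOfSingularities.Theorems.WeightedInvariantLocalWeightedDropWildMonicFlagDropKangaroo
import Summits.ResolutionOfSingularities.ResolutionOfSingularities.Theorems.WeightedInvariantLocalWeightedDropWildMonicFlagDropAxisN0ChildMax
import Summits.ResolutionOfSingularities.ResolutionOfSingularities.Theorems.WeightedInvariantLocalWeightedDropWildMonicFlagPos
import Summits.ResolutionOfSingularities.ResolutionOfSingularities.Theorems.WeightedInvariantLocalWeightedDropWildMonicKangarooBlowupInit

/-!
# `WeightedInvariant.LocalWeightedDrop`, line `hasse-ridge-face-selection`, S3ρ flag line: Uk-ρD3 — THE KANGAROO PACKAGE HOLDS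
# (`axisPackageKangaroo_holds`), hence `DropAxisKangaroo` unconditionally

Crux item stmt-ResolutionOfSingularities-8899 `LocalWeightedDrop` (route `ResolutionOfSingularities/WeightedInvariant`), engine of the door
`HypersurfaceCentreConstruction` stmt-ResolutionOfSingularities-19897.  [OURS · L1 W4.3, chain w43, seat res-type-056 (Uk-ρD3).  MODEL:
S. Perlega, arXiv:2011.14443, proof of Prop. 9.1.4 case (4) at `t = 0` [cite: Perlega2020, Prop. 9.1.4 (4) p0105–0106: «we can assume that
`f` is clean with respect to `J_{2,x₁}(a)` for any weighted order function … this implies that `𝓕` is valid»; Prop. 6.1.1 (2) (cleanness is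
transported along a point blowup, source weight `(w′₀, w′₀ + w′₁)`); Prop. 6.2.4 (1) (`n·d₁ ≤ d_gen`)]; every object OURS (res-L1-w43-stub-3's
flag family, res-type-083's `IsAxisStep` / `DropAxisKangaroo`, res-L1-w43-stub-7's simultaneous cleaning `exists_shift_isWClean_list` and
validity `isMMax_zero_of_isWClean`, their axis-successor dictionary `exists_induced_hypersurface` / `isWClean_induced_iff` /
`newtonSet_induced`, res-L1-w43-stub-1's `exists_isMMax_dRes_pos`); not a statement of any manuscript [claim: Hironaka2017, status:
under-review].]

* Swap laws for a general weight `(a, b)`: `weight_swapPt`, `weightedOrder_swap`, `slotWOrd_swapT`, `wMin_swapT`, `mem_initSupp_swap_iff`,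
  `isWClean_swapT_iff` (`(a,b)`-cleanness of the letter swap is `(b,a)`-cleanness), `initPts_swap`, `dInit_swap`; `srcWeight_n_one`.
* `axisPackageKangaroo_holds : AxisPackageKangaroo d p k` over a perfect field of characteristic `p`: clean the parent simultaneously for
  `(1,0)`, `(0,1)`, `(n, n+1)` (no `m_w` lowered, so the re-centring has no linear `x₀`-term and induces a child re-centring `g₀′`); the clean
  parent flag `(g₀, 0)` is valid; the induced child tuple is `(n,1)`-clean (Prop. 6.1.1 (2)), non-zero off `Exit₃`, with Newton set `Ψ_{d!}` of
  the parent's, so its letter swap `ψ = swap g₀′` is `(1,n)`-clean on the swapped child with `n · dInit ≤ d_𝓕` (Prop. 6.2.4 (1),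
  `mul_dInit_image_psi_le_dRes`); if `d_𝓕 = 0` for the clean flag, stub-1's valid flag with `d > 0` serves as `g₀` instead (the inequality's
  left side is then `0`).
* `dropAxisKangaroo_holds : DropAxisKangaroo d p k` — Uk-ρD3 (`t = 0`) by name, from `dropAxisKangaroo_of_package`.
AI-written; gate-accepted means sorry-free with standard axioms, not refereed.
-/

set_option linter.dupNamespace false -- mandated namespace of this single-conjunct summit

noncomputable section

namespace Summit.ResolutionOfSingularities.ResolutionOfSingularities.Theorems

open Literature.AlgebraicGeometry.Resolution

namespace WildMonic

open MvPowerSeries MonicDescent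
open PurePowerFlag (swap swapE succE)

variable {k : Type} [Field k] {d : ℕ}

/-! ### Swap laws for a general weight -/

/-- The `(a, b)`-weight of the transposed point is the `(b, a)`-weight of the point. -/
theorem weight_swapPt (a b : ℕ) (e : Fin 2 →₀ ℕ) :
    Finsupp.weight (![a, b] : Fin 2 → ℕ) (Finsupp.equivMapDomain (Equiv.swap (0 : Fin 2) 1) e) =
      Finsupp.weight (![b, a] : Fin 2 → ℕ) e := by
  rw [weight_fin_two, weight_fin_two, swapPt_apply_zero, swapPt_apply_one]
  simp only [Matrix.cons_val_zero, Matrix.cons_val_one, Matrix.cons_val_fin_one]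
  ring

/-- The `(a, b)`-order of the letter swap is the `(b, a)`-order. -/
theorem weightedOrder_swap (a b : ℕ) (B : MvPowerSeries (Fin 2) k) :
    (swap B).weightedOrder (![a, b] : Fin 2 → ℕ) = B.weightedOrder (![b, a] : Fin 2 → ℕ) := by
  have key : ∀ (a b : ℕ) (B : MvPowerSeries (Fin 2) k),
      B.weightedOrder (![b, a] : Fin 2 → ℕ) ≤ (swap B).weightedOrder (![a, b] : Fin 2 → ℕ) := by
    intro a b B
    refine le_weightedOrder _ fun e he => ?_
    rw [PurePowerFlag.coeff_swap]
    apply coeff_eq_zero_of_lt_weightedOrder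
    rw [weight_swapPt]
    exact he
  refine le_antisymm ?_ (key a b B)
  have h := key b a (swap B)
  rwa [PurePowerFlag.swap_swap] at h

/-- The scaled `(a, b)`-slot orders of the swapped tuple are the scaled `(b, a)`-slot orders. -/
theorem slotWOrd_swapT (a b : ℕ) (A : Fin d → MvPowerSeries (Fin 2) k) (j : Fin d) :
    slotWOrd ![a, b] (swapT A) j = slotWOrd ![b, a] A j := by
  rw [slotWOrd, slotWOrd, swapT_apply, weightedOrder_swap]

/-- `m_{(a,b)}` of the swapped tuple is `m_{(b,a)}`. -/
theorem wMin_swapT (a b : ℕ) (A : Fin d → MvPowerSeries (Fin 2) k) : wMin ![a, b] (swapT A) = wMin ![b, a] A := by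
  simp only [wMin, slotWOrd_swapT]

/-- The `(a, b)`-initial exponents of the letter swap are the transposed `(b, a)`-initial exponents. -/
theorem mem_initSupp_swap_iff (a b : ℕ) (B : MvPowerSeries (Fin 2) k) (e : Fin 2 →₀ ℕ) :
    e ∈ initSupp ![a, b] (swap B) ↔ Finsupp.equivMapDomain (Equiv.swap (0 : Fin 2) 1) e ∈ initSupp ![b, a] B := by
  simp only [initSupp, Set.mem_setOf_eq, PurePowerFlag.coeff_swap, weight_swapPt, weightedOrder_swap]

/-- `(a, b)`-CLEANNESS OF THE LETTER SWAP IS `(b, a)`-CLEANNESS (the three clauses of Perlega §5.1.1 are symmetric in the letters). -/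
theorem isWClean_swapT_iff (p a b : ℕ) (A : Fin d → MvPowerSeries (Fin 2) k) :
    IsWClean p ![a, b] (swapT A) ↔ IsWClean p ![b, a] A := by
  have imp : ∀ (a b : ℕ) (A : Fin d → MvPowerSeries (Fin 2) k), IsWClean p ![a, b] (swapT A) → IsWClean p ![b, a] A := by
    intro a b A h
    rcases h with ⟨i, hi, hiw⟩ | h2 | ⟨i, e, hi, he, hne⟩
    · exact Or.inl ⟨i, hi, by rwa [slotWOrd_swapT, wMin_swapT] at hiw⟩
    · refine Or.inr (Or.inl fun i hi => ?_)
      have h := h2 i hi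
      rwa [slotWOrd_swapT, wMin_swapT] at h
    · refine Or.inr (Or.inr ⟨i, Finsupp.equivMapDomain (Equiv.swap (0 : Fin 2) 1) e, hi, ?_, ?_⟩)
      · rwa [swapT_apply, mem_initSupp_swap_iff] at he
      · rwa [swapPt_apply_zero, swapPt_apply_one, and_comm]
  refine ⟨imp a b A, fun h => imp b a (swapT A) ?_⟩
  rwa [swapT_swapT]

/-- The `(a, b)`-initial points of the transposed set are the transposed `(b, a)`-initial points. -/
theorem initPts_swap (a b : ℕ) (N : Set (Fin 2 →₀ ℕ)) :
    initPts ![a, b] (Finsupp.equivMapDomain (Equiv.swap (0 : Fin 2) 1) '' N) =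
      Finsupp.equivMapDomain (Equiv.swap (0 : Fin 2) 1) '' initPts ![b, a] N := by
  have hinf : sInf (Finsupp.weight (![a, b] : Fin 2 → ℕ) '' (Finsupp.equivMapDomain (Equiv.swap (0 : Fin 2) 1) '' N)) =
      sInf (Finsupp.weight (![b, a] : Fin 2 → ℕ) '' N) := by
    rw [Set.image_image]
    congr 1
    exact Set.image_congr fun P _ => weight_swapPt a b P
  ext P
  simp only [mem_initPts_iff, Set.mem_image, hinf]
  constructor
  · rintro ⟨⟨Q, hQ, rfl⟩, hw⟩
    exact ⟨Q, ⟨hQ, by rwa [weight_swapPt] at hw⟩, rfl⟩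
  · rintro ⟨Q, ⟨hQ, hw⟩, rfl⟩
    exact ⟨⟨Q, hQ, rfl⟩, by rwa [weight_swapPt]⟩

/-- `dInit` IS SYMMETRIC: `dInit (a,b)` of the transposed set is `dInit (b,a)` (`δ` symmetric, `α ↔ ε`). -/
theorem dInit_swap (a b : ℕ) (N : Set (Fin 2 →₀ ℕ)) :
    dInit ![a, b] (Finsupp.equivMapDomain (Equiv.swap (0 : Fin 2) 1) '' N) = dInit ![b, a] N := by
  rw [dInit, dInit, initPts_swap, deltaL_swap, alphaL_swap, epsL_swap, Nat.sub_right_comm]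

/-- The source weight of the kangaroo weight `(n, 1)` is `(n, n+1)`. -/
theorem srcWeight_n_one (n : ℕ) : srcWeight (![n, 1] : Fin 2 → ℕ) = ![n, n + 1] := by
  funext i; fin_cases i <;> simp [srcWeight]

/-! ### The package -/

/-- THE KANGAROO PACKAGE HOLDS over a perfect field of characteristic `p` (Perlega Prop. 9.1.4 case (4), parent side: simultaneous cleaning,
validity of the clean flag, transport of `(n, n+1)`-cleanness to `(n,1)`-cleanness of the induced child tuple, letter swap, Prop. 6.2.4 (1)). -/
theorem axisPackageKangaroo_holds (p : ℕ) [Fact p.Prime] [CharP k p] [PerfectRing k p] : AxisPackageKangaroo d p k := by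
  intro A E T φ' hstep n hn
  obtain ⟨hA, hex, hT, hφ', -, hexC⟩ := hstep
  have hd : 0 < d := by
    refine Nat.pos_of_ne_zero fun hd0 => ?_
    subst hd0
    exact hex (exit₃_of_eq_zero hA fun j => j.elim0)
  have hA0 : ∀ j, constantCoeff (A j) = 0 := constantCoeff_eq_zero_of_isPos hA
  have hn1 : 1 ≤ n := by omega
  -- parent: simultaneous cleaning for `(1,0)`, `(0,1)`, `(n, n+1)`, no `m_w` lowered
  obtain ⟨g₁, hg₁, hmono, hor⟩ := exists_shift_isWClean_list p hd A hA0 [![1, 0], ![0, 1], ![n, n + 1]]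
  have hne : shift d A g₁ ≠ 0 := fun h0 => hex (exit₃_of_shift_eq_zero p hg₁ h0)
  obtain ⟨hws, -⟩ := hor.resolve_right hne
  have h10 : IsWClean p ![1, 0] (shift d A g₁) := hws _ (by simp)
  have h01 : IsWClean p ![0, 1] (shift d A g₁) := hws _ (by simp)
  have hnn : IsWClean p ![n, n + 1] (shift d A g₁) := hws _ (by simp)
  have hnz : ∀ g : MvPowerSeries (Fin 2) k, constantCoeff g = 0 → (newtonSet (shift d A g)).Nonempty :=
    fun g hg => newtonSet_shift_nonempty_of_not_exit₃ hex hg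
  have hmm₁ : IsMMax d A E g₁ 0 := isMMax_zero_of_isWClean p E A hnz hg₁ (fun _ => h10) (fun _ => h01)
  -- the induced child hypersurface `g′` of `g₁` (no linear `x₀`-term since `m_{(1,1)}` is not lowered)
  have hlin : coeff (Finsupp.single 0 1) g₁ = 0 := coeff_X₀_eq_zero_of_wMin_le hd hA (hmono ![1, 1])
  obtain ⟨g', hg', hind⟩ := exists_induced_hypersurface hT hφ' hg₁ hlin
  have hcleanC' : IsWClean p ![n, 1] (flagTuple d (shift d T φ') g' 0) := by
    refine (isWClean_induced_iff p hA hg₁ hind ![n, 1]).mpr ?_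
    rw [srcWeight_n_one, flagTuple_zero_shear]
    exact hnn
  have hC'ne : flagTuple d (shift d T φ') g' 0 ≠ 0 := by
    rw [flagTuple_zero_shear]
    exact fun h0 => hexC (exit₃_of_shift_eq_zero p hg' h0)
  have hfin : wMin ![n, 1] (flagTuple d (shift d T φ') g' 0) ≠ ⊤ := wMin_ne_top_of_ne_zero _ hC'ne
  have hNS : newtonSet (flagTuple d (shift d T φ') g' 0) = psi d.factorial '' newtonSet (flagTuple d A g₁ 0) :=
    newtonSet_induced hA hg₁ hind
  have hN : (newtonSet (flagTuple d A g₁ 0)).Nonempty := newtonSet_flagTuple_zero_nonempty_of_not_exit₃ hex hg₁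
  have hL : ∀ Q ∈ newtonSet (flagTuple d A g₁ 0), d.factorial ≤ Q 0 + Q 1 :=
    fun Q hQ => factorial_le_of_mem_newtonSet_flagTuple_zero hA hg₁ hQ
  have h624 : n * dInit ![n, 1] (newtonSet (flagTuple d (shift d T φ') g' 0)) ≤ dRes E (newtonSet (flagTuple d A g₁ 0)) := by
    rw [hNS]
    exact mul_dInit_image_psi_le_dRes (w := ![n, 1]) (by simp) (by simp) E hn1 hN hL
  -- the letter swap: `ψ = swap g′` on the swapped child
  have hψ : constantCoeff (swap g') = 0 := by rw [swap, constantCoeff_rename]; exact hg'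
  have hflag : flagTuple d (swapT (shift d T φ')) (swap g') 0 = swapT (flagTuple d (shift d T φ') g' 0) := by
    rw [flagTuple_swapT_zero, PurePowerFlag.swap_swap]
  have hclean : IsWClean p ![1, n] (flagTuple d (swapT (shift d T φ')) (swap g') 0) := by
    rw [hflag, isWClean_swapT_iff]; exact hcleanC'
  have hfin' : wMin ![1, n] (flagTuple d (swapT (shift d T φ')) (swap g') 0) ≠ ⊤ := by
    rw [hflag, wMin_swapT]; exact hfin
  have hdInit : dInit ![1, n] (newtonSet (flagTuple d (swapT (shift d T φ')) (swap g') 0)) =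
      dInit ![n, 1] (newtonSet (flagTuple d (shift d T φ') g' 0)) := by
    rw [hflag, newtonSet_swapT, dInit_swap]
  -- the package: the clean flag if non-terminal, else stub-1's valid flag with `d > 0`
  by_cases hpos : 0 < dRes E (newtonSet (flagTuple d A g₁ 0))
  · exact ⟨g₁, swap g', hg₁, hψ, hmm₁, hpos, hclean, hfin', by rw [hdInit]; exact h624⟩
  · obtain ⟨g₂, hg₂, hmm₂, hpos₂⟩ := exists_isMMax_dRes_pos p hd hA hex E
    refine ⟨g₂, swap g', hg₂, hψ, hmm₂, by rwa [flagTuple_zero_shear], hclean, hfin', ?_⟩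
    rw [hdInit]
    exact h624.trans (by omega)

/-- Uk-ρD3 BY NAME (`t = 0`): `DropAxisKangaroo d p k` over a perfect field of characteristic `p` — every valid kangaroo flag of the child of a
charged axis step (second orientation, tangent of order `n ≥ 2` to the new exceptional curve) is dominated strictly in the first component by
a valid parent flag (Perlega Prop. 9.1.4 case (4)). -/
theorem dropAxisKangaroo_holds (p : ℕ) [Fact p.Prime] [CharP k p] [PerfectRing k p] : DropAxisKangaroo d p k :=
  dropAxisKangaroo_of_package (axisPackageKangaroo_holds p)

end WildMonic

end Summit.ResolutionOfSingularities.ResolutionOfSingularities.Theorems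

end
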